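import Summits.BirchSwinnertonDyer.Rank1Residual.X11b.CastellaErratum
import HarnessLib

/-!
# Rung K2 at `p ≥ 5` (class X11b, board atom B9): the two ANNOUNCED rank-one statements BY NAME —
# Castella's erratum Thm. A′ and Skinner–Zhang 2014 Thm. 1.2 — give `BSD(E,p)` on the UNION of their
# printed shapes, and are both silent off (ram) (cell `bsd-stepL`, seat `bsd-stepL-mult-p3`, session g0;
# `--supports stmt-BirchSwinnertonDyer-20337`)

HONEST FRAMING (cell `bsd-stepL`, HOME `run/shared/lean/pub/bsd-stepL/`): a ONE-SCREEN by-name class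
statement for the director's headline («Castella 2018 BY NAME ⇒ B9@≥5 class theorem»), assembled from the
b2b cell's per-shape theorems (`X11b.CastellaErratum.bsdp_of_erratumHypotheses_of_thmAprime_OPEN`,
`Rank1Residual.bsdp_of_skinnerZhang_OPEN`, `Rank1Residual.not_skinnerZhang_and_not_erratumAprime_of_not_ram`).
Both inputs are OPEN Literature binders carrying `[claim: …, status: under-review]`: Castella's web
erratum Thm. A′ (proof via Fouquet–Wan arXiv:2107.13726 Thm. 4.41, unrefereed; = the K2 crux 20337
`CastellaErratumMemberPackage` taken as ONE black box together with Cas18 §5) and Skinner–Zhang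
arXiv:1407.1099 Thm. 1.2 (unrefereed since 2014). So the theorem below is CONDITIONAL on two unrefereed
claims; it is NOT a beyond-print theorem; nothing is booked; X11b stays CONSTRUCTION-SHAPED (T7).
Census of record (b2b `X11b/BDPRouteSources.lean`, kit j086753, N < 5·10⁵, p ≥ 5, X11b shape
2 267 348 pairs): A′-shape 1 603 386, SZ-shape 2 037 828, A′ ∪ SZ = 2 123 206 (93.6 %); pairs with no
announced source 144 142 (6.4 %), of which (ram) ∧ p ∤ ∏c without source 21 356.

* `X11b.bsdp_of_classX11b_of_announcedShapes_OPEN` — for `(E,p) ∈` X11b, `p ≥ 5`, on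
  (A′-locus: a NON-split multiplicative `q ≠ p` with `E[p]` ramified at `q`, and `E(ℚ_p)[p] = 0`) ∪
  (SZ-shape: hypotheses (a)–(e) of SZ14 Thm. 1.1), `BSDp W p` — modulo the two OPEN binders + GZK.
* `X11b.not_announcedShapes_of_not_ram` — off (ram) both shapes are EMPTY: the ¬(ram) atoms of
  B9 (¬ram ∧ surj 57 086 cw; split-only 55 089; the T4′ corner) have no announced source.

References: [Castella2018Erratum] Thm. A′; [Castella2018] §5; [SkinnerZhang2014] Thms. 1.1–1.2;
[FouquetWan2021] Thm. 4.41; [Miller2011LMS] Def. 1.1.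
-/

noncomputable section

open scoped Classical

namespace Summit.BirchSwinnertonDyer.Rank1Residual.X11b

open WeierstrassCurve Literature.NumberTheory.EllipticCurves
  Literature.NumberTheory.EllipticCurves.Rank1Residual
  Literature.NumberTheory.EllipticCurves.Rank1Residual.Typed
  Summit.BirchSwinnertonDyer.Rank1Residual

/-- **B9@≥5 BY NAME: `BSD(E,p)` on (A′-locus ∪ SZ-shape) of class X11b at `p ≥ 5` — CONDITIONAL on the
two OPEN binders** `Castella2018.erratum_thmAprime_padicVal_bsd_rankOne_OPEN` (hA′) and
`SkinnerZhang2014.thm1_2_padicVal_bsd_rankOne_OPEN` (hSZ), plus Gross–Zagier–Kolyvagin (hGZK). For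
`W/ℚ` globally minimal with `(E,p) ∈` X11b (`r_an = 1`, `p ∥ N`, `E[p]` irreducible) and `5 ≤ p`: if
either `X11.AprimeLocusAt W p` (a non-split multiplicative `q ≠ p` with `p ∤ v_q(Δ_min)` and
`E(ℚ_p)[p] = 0`) or `SkinnerZhang2014.Hypotheses W p` ((a)–(e) of SZ14 Thm. 1.1), then `BSDp W p`.
By cases on the b2b cell's per-shape theorems. NOT a theorem of the refereed record; nothing booked.
[claim: Castella2018Erratum, status: under-review] [claim: SkinnerZhang2014, status: under-review]
[cite: Miller2011LMS, Def. 1.1] -/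
theorem bsdp_of_classX11b_of_announcedShapes_OPEN
    (hA' : Castella2018.erratum_thmAprime_padicVal_bsd_rankOne_OPEN)
    (hSZ : SkinnerZhang2014.thm1_2_padicVal_bsd_rankOne_OPEN)
    (hGZK : rank_eq_analyticRank_of_analyticRank_le_one)
    (W : WeierstrassCurve ℚ) [W.IsElliptic] [W.IsGloballyMinimal] (p : ℕ) [Fact p.Prime]
    (hX : ClassX11b W p) (hp : 5 ≤ p)
    (h : X11.AprimeLocusAt W p ∨ SkinnerZhang2014.Hypotheses W p) : BSDp W p := by
  rcases h with hA | hH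
  · exact bsdp_of_erratumHypotheses_of_thmAprime_OPEN W p hA' hGZK ⟨hp, hX.2.2.1, hX.2.2.2, hA⟩ hX.1
  · exact bsdp_of_skinnerZhang_OPEN W p hSZ hGZK hp hH hX.1

/-- **Off (ram) both announced shapes are empty**: if `(E,p)` has NO E[p]-ramified multiplicative prime
`q ≠ p` (`¬ Rank1Residual.Ram W p`), then neither the A′-locus nor SZ14's hypotheses (a)–(e) hold — the
¬(ram) atoms of B9 have no announced source (b2b `X11.lean`, repackaged). Bookkeeping.
[cite: SkinnerZhang2014, Thm. 1.1 (e)] [claim: Castella2018Erratum, status: under-review] -/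
theorem not_announcedShapes_of_not_ram
    (W : WeierstrassCurve ℚ) [W.IsElliptic] [W.IsGloballyMinimal] (p : ℕ) [Fact p.Prime]
    (hnr : ¬ Ram W p) : ¬ (X11.AprimeLocusAt W p ∨ SkinnerZhang2014.Hypotheses W p) := by
  rintro (hA | hH)
  · exact hnr (X11.ram_of_aprimeLocusAt hA)
  · exact hnr (ram_of_skinnerZhang_hypotheses hH)

end Summit.BirchSwinnertonDyer.Rank1Residual.X11b

end
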